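import Summits.QuantumFields.YangMills.Theorems.IR.LargeFieldRarityIncrement

/-!
# Large-field rarity package, file 4∕5: the engine — (CB)+(EM) ⇒ (R-even) and (CZ on 𝓛)+(FE) ⇒ (R on 𝓛) — PROVED

Landed for item `stmt-QuantumFields-19354` (`--supports … --as helper`) by the LEAD prover ab-p1 under director-ym RULING g9-№2 ∕ №14 (3)
(critic ym-ir-crit-1 GATE 2026-08-28T03:18:39Z: supplier PROVED, land under `Theorems/IR/`); authored by ideator ym-ir-idea-4 g3, split of the
sorry-free workfile `Cruxes/IR/Lines/largefield_rarity_chessboard.lean` v8 per `Cruxes/IR/Lines/largefield_rarity_chessboard_LANDING.md`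
(five files: `LargeFieldRarityDefs` → {`…FiniteSize`, `…Increment`} → `…Engine` → `…OddTori`).

Content: §5 `largeSet_props`, `measureReal_orientation_le`, `largeFieldRarityEven_of : ChessboardEvents → ExpMomentBoundFrom fl → LargeFieldRarityEvenFrom fl`;
§6 `measureReal_largeField_le` (exponential Chebyshev on `Q` FIRST), `largeFieldRarityOn_of_ZRatio : ChessboardZRatio 𝓛 → FreeEnergyIncrementFrom fl →
LargeFieldRarityOnFrom 𝓛 fl` (then the chessboard on the exponential functional and (FE) at `β' = (1−kθ)β`: the `log β`'s cancel; `c = θ/4`).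

HONESTY.  Nothing here proves the Clay Yang–Mills mass gap, a lattice mass gap, `BalabanLadder.IR`, (T) or (M-b); R4 of the
ladder closes only the conditional finite-𝕋⁴ rung `BalabanLadder.UV`.
-/

noncomputable section

open MeasureTheory Finset
open Literature.MathematicalPhysics.QuantumFieldTheory Literature.MathematicalPhysics.QuantumLattice
open Summit.QuantumFields.YangMills.Theorems (OddTorusChessboard.Orient OddTorusChessboard.wilsonExpectation_expObs_le_exp_card_all
  SoloBlind.expObs)

namespace Summit.QuantumFields.YangMills.Cruxes.IR.LargeFieldRarityChessboard

/-! ## §5 SEAM 2 (proved): (CB) + (EM) ⇒ (R-even) -/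

section Seam2

variable {G : Type} [Group G] [TopologicalSpace G] [IsTopologicalGroup G] [CompactSpace G]
  [MeasurableSpace G] [BorelSpace G]

/-- The large-field set `E_t = {g | t < N − Re tr ρ g}` is measurable, conjugation- and inversion-invariant. -/
theorem largeSet_props (r : LatticeRep G) (t : ℝ) :
    MeasurableSet {g : G | t < (r.N : ℝ) - ((r.ρ g).trace).re} ∧
      (∀ g h : G, h * g * h⁻¹ ∈ {g : G | t < (r.N : ℝ) - ((r.ρ g).trace).re} ↔
        g ∈ {g : G | t < (r.N : ℝ) - ((r.ρ g).trace).re}) ∧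
      (∀ g : G, g⁻¹ ∈ {g : G | t < (r.N : ℝ) - ((r.ρ g).trace).re} ↔
        g ∈ {g : G | t < (r.N : ℝ) - ((r.ρ g).trace).re}) := by
  have hcont : Continuous fun g : G => (r.N : ℝ) - ((r.ρ g).trace).re :=
    continuous_const.sub (Complex.continuous_re.comp r.continuous.matrix_trace)
  refine ⟨(isOpen_lt continuous_const hcont).measurableSet, fun g h => ?_, fun g => ?_⟩
  · simp only [Set.mem_setOf_eq,
      Literature.RepresentationTheory.CompactGroups.CompactGroup.trace_conj_eq r.ρ g h]
  · simp only [Set.mem_setOf_eq,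
      Literature.RepresentationTheory.CompactGroups.CompactGroup.re_trace_map_inv r.ρ r.continuous g]

/-- **Exponential Chebyshev on the full array of one orientation**: `μ{∀ p ∈ o, s_p > A/(2β)} ≤ e^{-λ A L⁴/2} ⟨∏_{p∈o} e^{λβ s_p}⟩`. -/
theorem measureReal_orientation_le (r : LatticeRep G) {L : ℕ} [NeZero L] {β lam A : ℝ} (hβ : 0 < β) (hlam : 0 < lam)
    (o : {q : Fin 4 × Fin 4 // q.1 < q.2}) :
    (wilsonMeasure (d := 4) (L := L) r.ρ β).real
        {U | ∀ p : Literature.MathematicalPhysics.QuantumFieldTheory.Plaquette 4 L, p.2 = o →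
          plaquetteHolonomy U p.1 p.2.1.1 p.2.1.2 ∈ {g : G | A / (2 * β) < (r.N : ℝ) - ((r.ρ g).trace).re}} ≤
      Real.exp (-(lam * A / 2 * (L : ℝ) ^ 4)) *
        ∫ U, ∏ p ∈ (Finset.univ.filter fun p : Literature.MathematicalPhysics.QuantumFieldTheory.Plaquette 4 L => p.2 = o),
          Real.exp (lam * β * plaqCost r.ρ U p) ∂(wilsonMeasure (d := 4) (L := L) r.ρ β) := by
  haveI := isProbabilityMeasure_wilsonMeasure (d := 4) (L := L) (G := G) r.ρ r.continuous β
  set Fo := (Finset.univ.filter fun p : Literature.MathematicalPhysics.QuantumFieldTheory.Plaquette 4 L => p.2 = o) with hFo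
  set Sev : Set (GaugeConfig 4 L G) :=
    {U | ∀ p : Literature.MathematicalPhysics.QuantumFieldTheory.Plaquette 4 L, p.2 = o →
      plaquetteHolonomy U p.1 p.2.1.1 p.2.1.2 ∈ {g : G | A / (2 * β) < (r.N : ℝ) - ((r.ρ g).trace).re}} with hSev
  -- cardinality of one orientation: `L⁴`
  have hcard : (Fo.card : ℝ) = (L : ℝ) ^ 4 := by
    have h1 : Fo = Finset.univ.image
        (fun x : Literature.MathematicalPhysics.QuantumFieldTheory.Site 4 L =>
          ((x, o) : Literature.MathematicalPhysics.QuantumFieldTheory.Plaquette 4 L)) := by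
      ext p
      simp only [hFo, Finset.mem_filter, Finset.mem_univ, true_and, Finset.mem_image]
      constructor
      · intro hp; exact ⟨p.1, by rw [← hp]⟩
      · rintro ⟨x, rfl⟩; rfl
    rw [h1, Finset.card_image_of_injective _ (fun x y hxy => by simpa using congrArg Prod.fst hxy),
      Finset.card_univ, Fintype.card_pi, Finset.prod_const, Finset.card_univ, Fintype.card_fin, ZMod.card]
    push_cast
    ring
  -- measurability of the event
  have hSm : MeasurableSet Sev := by
    have : Sev = ⋂ p ∈ Fo, {U | A / (2 * β) < plaqCost r.ρ U p} := by
      ext U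
      simp only [hSev, hFo, Set.mem_setOf_eq, Set.mem_iInter, Finset.mem_filter, Finset.mem_univ, true_and, plaqCost]
    rw [this]
    exact MeasurableSet.biInter (Set.to_countable _) fun p _ =>
      measurableSet_lt measurable_const (measurable_plaqCost r p)
  -- the dominating function
  set g : GaugeConfig 4 L G → ℝ := fun U =>
    Real.exp (-(lam * A / 2 * (L : ℝ) ^ 4)) * ∏ p ∈ Fo, Real.exp (lam * β * plaqCost r.ρ U p) with hg
  have hgm : Measurable g :=
    measurable_const.mul (Finset.measurable_prod _ fun p _ =>
      Real.measurable_exp.comp ((measurable_plaqCost r p).const_mul _))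
  have hgb : ∀ U, ‖g U‖ ≤ Real.exp (-(lam * A / 2 * (L : ℝ) ^ 4)) * Real.exp (lam * β * (2 * r.N)) ^ Fo.card := by
    intro U
    have hg0 : 0 ≤ g U := mul_nonneg (Real.exp_pos _).le (Finset.prod_nonneg fun p _ => (Real.exp_pos _).le)
    rw [Real.norm_eq_abs, abs_of_nonneg hg0, hg]
    refine mul_le_mul_of_nonneg_left ?_ (Real.exp_pos _).le
    rw [← Finset.prod_const]
    exact Finset.prod_le_prod (fun p _ => (Real.exp_pos _).le) fun p _ =>
      Real.exp_le_exp.2 (mul_le_mul_of_nonneg_left (plaqCost_le r U p) (by positivity))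
  have hgi : Integrable g (wilsonMeasure (d := 4) (L := L) r.ρ β) :=
    (integrable_const _).mono' hgm.aestronglyMeasurable (ae_of_all _ hgb)
  -- pointwise: indicator ≤ g
  have hptw : ∀ U, Sev.indicator (fun _ => (1 : ℝ)) U ≤ g U := by
    intro U
    by_cases hU : U ∈ Sev
    · rw [Set.indicator_of_mem hU, hg]
      have hexp : Real.exp (-(lam * A / 2 * (L : ℝ) ^ 4)) * Real.exp (lam * A / 2) ^ Fo.card = 1 := by
        rw [← Real.exp_nat_mul, ← Real.exp_add, hcard]
        convert Real.exp_zero using 2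
        ring
      rw [← hexp]
      refine mul_le_mul_of_nonneg_left ?_ (Real.exp_pos _).le
      rw [← Finset.prod_const]
      refine Finset.prod_le_prod (fun p _ => (Real.exp_pos _).le) fun p hp => Real.exp_le_exp.2 ?_
      have hp' : p.2 = o := by simpa [hFo] using hp
      have hlt : A / (2 * β) < plaqCost r.ρ U p := hU p hp'
      have : lam * A / 2 = lam * β * (A / (2 * β)) := by field_simp
      rw [this]
      exact mul_le_mul_of_nonneg_left hlt.le (by positivity)
    · rw [Set.indicator_of_notMem hU]
      exact mul_nonneg (Real.exp_pos _).le (Finset.prod_nonneg fun p _ => (Real.exp_pos _).le)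
  calc (wilsonMeasure (d := 4) (L := L) r.ρ β).real Sev
      = ∫ U, Sev.indicator (fun _ => (1 : ℝ)) U ∂(wilsonMeasure (d := 4) (L := L) r.ρ β) :=
        (integral_indicator_one hSm).symm
    _ ≤ ∫ U, g U ∂(wilsonMeasure (d := 4) (L := L) r.ρ β) :=
        integral_mono_of_nonneg (ae_of_all _ fun U => Set.indicator_nonneg (fun _ _ => zero_le_one) U) hgi
          (ae_of_all _ hptw)
    _ = _ := by rw [hg, integral_const_mul]

end Seam2

/-- **(CB) + (EM) ⇒ (R-even)**: on the full array of each orientation exponential Chebyshev and (EM) give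
`μ{∀ p ∈ o, s_p > A/(2β)} ≤ e^{(C − λA/2)L⁴}`; the chessboard estimate raises this to the power `#Q_o/(6L⁴)` and multiplies
over the six orientations: `μ{∀ p ∈ Q, s_p > A/(2β)} ≤ e^{(C − λA/2)|Q|/6} ≤ e^{−(λ/24) A |Q|}` once `A ≥ 4C/λ`. -/
theorem largeFieldRarityEven_of {fl : ℝ → ℕ} (hCB : ChessboardEvents) (hEM : ExpMomentBoundFrom fl) : LargeFieldRarityEvenFrom fl := by
  intro G _ _ _ _ hG
  letI : MeasurableSpace G := borel G
  haveI : BorelSpace G := ⟨rfl⟩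
  intro r
  obtain ⟨lam, C, β₃, hlam, hβ₃, hem⟩ := hEM G hG r
  refine ⟨lam / 24, 4 * C / lam, β₃, by positivity, ?_⟩
  intro A hA β hβ L _ hLeven hL Q
  have hβpos : 0 < β := lt_of_lt_of_le hβ₃ hβ
  haveI := isProbabilityMeasure_wilsonMeasure (d := 4) (L := L) (G := G) r.ρ r.continuous β
  have hLnat : 0 < L := Nat.pos_of_ne_zero (NeZero.ne L)
  have hLr : (0 : ℝ) < (L : ℝ) := Nat.cast_pos.2 hLnat
  have hLpos : (0 : ℝ) < (L : ℝ) ^ 4 := by positivity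
  -- the large-field set
  set E : Set G := {g : G | A / (2 * β) < (r.N : ℝ) - ((r.ρ g).trace).re} with hE
  obtain ⟨hEm, hEconj, hEinv⟩ := largeSet_props r (A / (2 * β))
  -- chessboard
  have hcb := hCB G r L hLeven β hβpos.le E hEm hEconj hEinv Q
  -- per orientation bound
  have horient : ∀ o : {q : Fin 4 × Fin 4 // q.1 < q.2},
      (wilsonMeasure (d := 4) (L := L) r.ρ β).real
          {U | ∀ p : Literature.MathematicalPhysics.QuantumFieldTheory.Plaquette 4 L, p.2 = o →
            plaquetteHolonomy U p.1 p.2.1.1 p.2.1.2 ∈ E} ≤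
        Real.exp ((C - lam * A / 2) * (L : ℝ) ^ 4) := by
    intro o
    have h1 := measureReal_orientation_le r (L := L) (A := A) hβpos hlam o
    have h2 := hem L β hβ hL (Finset.univ.filter fun p => p.2 = o)
    calc _ ≤ Real.exp (-(lam * A / 2 * (L : ℝ) ^ 4)) * Real.exp (C * (L : ℝ) ^ 4) :=
          h1.trans (mul_le_mul_of_nonneg_left h2 (Real.exp_pos _).le)
      _ = Real.exp ((C - lam * A / 2) * (L : ℝ) ^ 4) := by rw [← Real.exp_add]; ring_nf
  -- combine
  have hpow : ∀ o : {q : Fin 4 × Fin 4 // q.1 < q.2},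
      ((wilsonMeasure (d := 4) (L := L) r.ρ β).real
          {U | ∀ p : Literature.MathematicalPhysics.QuantumFieldTheory.Plaquette 4 L, p.2 = o →
            plaquetteHolonomy U p.1 p.2.1.1 p.2.1.2 ∈ E}) ^
          (((Q.filter fun p => p.2 = o).card : ℝ) / (6 * (L : ℝ) ^ 4)) ≤
        Real.exp ((C - lam * A / 2) / 6 * ((Q.filter fun p => p.2 = o).card : ℝ)) := by
    intro o
    have hexp : 0 ≤ (((Q.filter fun p => p.2 = o).card : ℝ) / (6 * (L : ℝ) ^ 4)) := by positivity
    calc _ ≤ (Real.exp ((C - lam * A / 2) * (L : ℝ) ^ 4)) ^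
            (((Q.filter fun p => p.2 = o).card : ℝ) / (6 * (L : ℝ) ^ 4)) :=
          Real.rpow_le_rpow measureReal_nonneg (horient o) hexp
      _ = Real.exp ((C - lam * A / 2) / 6 * ((Q.filter fun p => p.2 = o).card : ℝ)) := by
          rw [← Real.exp_mul]
          congr 1
          field_simp
  have hprod : ∏ o : {q : Fin 4 × Fin 4 // q.1 < q.2},
      ((wilsonMeasure (d := 4) (L := L) r.ρ β).real
          {U | ∀ p : Literature.MathematicalPhysics.QuantumFieldTheory.Plaquette 4 L, p.2 = o →
            plaquetteHolonomy U p.1 p.2.1.1 p.2.1.2 ∈ E}) ^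
          (((Q.filter fun p => p.2 = o).card : ℝ) / (6 * (L : ℝ) ^ 4)) ≤
        Real.exp ((C - lam * A / 2) / 6 * (Q.card : ℝ)) := by
    calc _ ≤ ∏ o : {q : Fin 4 × Fin 4 // q.1 < q.2},
            Real.exp ((C - lam * A / 2) / 6 * ((Q.filter fun p => p.2 = o).card : ℝ)) :=
          Finset.prod_le_prod (fun o _ => Real.rpow_nonneg measureReal_nonneg _) fun o _ => hpow o
      _ = Real.exp ((C - lam * A / 2) / 6 * (Q.card : ℝ)) := by
          rw [← Real.exp_sum, ← Finset.mul_sum]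
          congr 2
          rw [Finset.card_eq_sum_card_fiberwise (f := fun p : Literature.MathematicalPhysics.QuantumFieldTheory.Plaquette 4 L => p.2)
            (t := Finset.univ) (fun p _ => Finset.mem_univ _)]
          push_cast
          rfl
  -- the rate
  have hrate : (C - lam * A / 2) / 6 * (Q.card : ℝ) ≤ -(lam / 24 * A * Q.card) := by
    have hA' : 4 * C ≤ lam * A := by
      have := (div_le_iff₀ hlam).1 hA
      linarith
    have hQ : (0 : ℝ) ≤ Q.card := Nat.cast_nonneg _
    nlinarith
  -- conclude
  have hreal : (wilsonMeasure (d := 4) (L := L) r.ρ β).real {U | ∀ p ∈ Q, A / (2 * β) < plaqCost r.ρ U p} ≤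
      Real.exp (-(lam / 24 * A * Q.card)) := by
    have hset : {U : GaugeConfig 4 L G | ∀ p ∈ Q, A / (2 * β) < plaqCost r.ρ U p} =
        {U | ∀ p ∈ Q, plaquetteHolonomy U p.1 p.2.1.1 p.2.1.2 ∈ E} := by
      ext U; simp only [Set.mem_setOf_eq, hE, plaqCost]
    rw [hset]
    exact hcb.trans (hprod.trans (Real.exp_le_exp.2 hrate))
  rw [← ENNReal.ofReal_toReal (measure_ne_top _ _)]
  exact ENNReal.ofReal_le_ofReal hreal

/-! ## §6 SEAM 3 (proved, parity-agnostic): (CZ on 𝓛) + (FE) ⇒ (R on 𝓛) — Chebyshev FIRST, then chessboard on the exponential functional -/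

section Seam3

variable {G : Type} [Group G] [TopologicalSpace G] [IsTopologicalGroup G] [CompactSpace G]
  [MeasurableSpace G] [BorelSpace G]

/-- **Exponential Chebyshev on `Q` itself**: `μ{∀ p ∈ Q, s_p > A/(2β)} ≤ e^{-λA|Q|/2} ⟨∏_{p∈Q} e^{λβ s_p}⟩`. -/
theorem measureReal_largeField_le (r : LatticeRep G) {L : ℕ} [NeZero L] {β lam A : ℝ} (hβ : 0 < β) (hlam : 0 < lam)
    (Q : Finset (Literature.MathematicalPhysics.QuantumFieldTheory.Plaquette 4 L)) :
    (wilsonMeasure (d := 4) (L := L) r.ρ β).real {U | ∀ p ∈ Q, A / (2 * β) < plaqCost r.ρ U p} ≤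
      Real.exp (-(lam * A / 2 * Q.card)) *
        ∫ U, ∏ p ∈ Q, Real.exp (lam * β * plaqCost r.ρ U p) ∂(wilsonMeasure (d := 4) (L := L) r.ρ β) := by
  haveI := isProbabilityMeasure_wilsonMeasure (d := 4) (L := L) (G := G) r.ρ r.continuous β
  set Sev : Set (GaugeConfig 4 L G) := {U | ∀ p ∈ Q, A / (2 * β) < plaqCost r.ρ U p} with hSev
  have hSm : MeasurableSet Sev := by
    have : Sev = ⋂ p ∈ Q, {U | A / (2 * β) < plaqCost r.ρ U p} := by
      ext U; simp only [hSev, Set.mem_setOf_eq, Set.mem_iInter]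
    rw [this]
    exact MeasurableSet.biInter (Set.to_countable _) fun p _ =>
      measurableSet_lt measurable_const (measurable_plaqCost r p)
  set g : GaugeConfig 4 L G → ℝ := fun U =>
    Real.exp (-(lam * A / 2 * Q.card)) * ∏ p ∈ Q, Real.exp (lam * β * plaqCost r.ρ U p) with hg
  have hgm : Measurable g :=
    measurable_const.mul (Finset.measurable_prod _ fun p _ =>
      Real.measurable_exp.comp ((measurable_plaqCost r p).const_mul _))
  have hgb : ∀ U, ‖g U‖ ≤ Real.exp (-(lam * A / 2 * Q.card)) * Real.exp (lam * β * (2 * r.N)) ^ Q.card := by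
    intro U
    have hg0 : 0 ≤ g U := mul_nonneg (Real.exp_pos _).le (Finset.prod_nonneg fun p _ => (Real.exp_pos _).le)
    rw [Real.norm_eq_abs, abs_of_nonneg hg0, hg]
    refine mul_le_mul_of_nonneg_left ?_ (Real.exp_pos _).le
    rw [← Finset.prod_const]
    exact Finset.prod_le_prod (fun p _ => (Real.exp_pos _).le) fun p _ =>
      Real.exp_le_exp.2 (mul_le_mul_of_nonneg_left (plaqCost_le r U p) (by positivity))
  have hgi : Integrable g (wilsonMeasure (d := 4) (L := L) r.ρ β) :=
    (integrable_const _).mono' hgm.aestronglyMeasurable (ae_of_all _ hgb)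
  have hptw : ∀ U, Sev.indicator (fun _ => (1 : ℝ)) U ≤ g U := by
    intro U
    by_cases hU : U ∈ Sev
    · rw [Set.indicator_of_mem hU, hg]
      have hexp : Real.exp (-(lam * A / 2 * Q.card)) * Real.exp (lam * A / 2) ^ Q.card = 1 := by
        rw [← Real.exp_nat_mul, ← Real.exp_add]
        convert Real.exp_zero using 2
        ring
      rw [← hexp]
      refine mul_le_mul_of_nonneg_left ?_ (Real.exp_pos _).le
      rw [← Finset.prod_const]
      refine Finset.prod_le_prod (fun p _ => (Real.exp_pos _).le) fun p hp => Real.exp_le_exp.2 ?_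
      have hlt : A / (2 * β) < plaqCost r.ρ U p := hU p hp
      have : lam * A / 2 = lam * β * (A / (2 * β)) := by field_simp
      rw [this]
      exact mul_le_mul_of_nonneg_left hlt.le (by positivity)
    · rw [Set.indicator_of_notMem hU]
      exact mul_nonneg (Real.exp_pos _).le (Finset.prod_nonneg fun p _ => (Real.exp_pos _).le)
  calc (wilsonMeasure (d := 4) (L := L) r.ρ β).real Sev
      = ∫ U, Sev.indicator (fun _ => (1 : ℝ)) U ∂(wilsonMeasure (d := 4) (L := L) r.ρ β) :=
        (integral_indicator_one hSm).symm
    _ ≤ ∫ U, g U ∂(wilsonMeasure (d := 4) (L := L) r.ρ β) :=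
        integral_mono_of_nonneg (ae_of_all _ fun U => Set.indicator_nonneg (fun _ _ => zero_le_one) U) hgi
          (ae_of_all _ hptw)
    _ = _ := by rw [hg, integral_const_mul]

end Seam3

/-- **(CZ on 𝓛) + (FE) ⇒ (R on 𝓛)**, every side class: exponential Chebyshev on `Q`, the chessboard-to-free-energy bound, and
the free-energy increment at `β' = (1−kθ)β`: `μ{∀ p ∈ Q, s_p > A/(2β)} ≤ e^{(−θA/2 + C₁)|Q|} ≤ e^{−(θ/4)A|Q|}` for `A ≥ 4C₁/θ`,
`C₁ = (ν₀ log(1/(1−kθ)) + C)/k`, `β ≥ β₃/(1−kθ)`, `L ≥ L₀(β)`, `L ∈ 𝓛`. -/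
theorem largeFieldRarityOn_of_ZRatio {𝓛 : Set ℕ} {fl : ℝ → ℕ} (hCZ : ChessboardZRatio 𝓛) (hFE : FreeEnergyIncrementFrom fl) :
    LargeFieldRarityOnFrom 𝓛 fl := by
  intro G _ _ _ _ hG
  letI : MeasurableSpace G := borel G
  haveI : BorelSpace G := ⟨rfl⟩
  intro r
  obtain ⟨k, θ, hθ, hk, hkθ, hcz⟩ := hCZ G r
  obtain ⟨ν₀, C, β₃, hβ₃, hinc⟩ := hFE G hG r
  have hk0 : 0 < k := lt_of_lt_of_le one_pos hk
  have h1kθ : 0 < 1 - k * θ := by linarith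
  set C₁ : ℝ := (ν₀ * Real.log (1 / (1 - k * θ)) + C) / k with hC₁
  refine ⟨θ / 4, 4 * C₁ / θ, β₃ / (1 - k * θ), by positivity, ?_⟩
  intro A hA β hβ L _ hL𝓛 hL Q
  have hβ₃' : β₃ ≤ β := by
    have h1 : β₃ / (1 - k * θ) ≥ β₃ := by
      rw [ge_iff_le, le_div_iff₀ h1kθ]
      nlinarith [mul_pos (mul_pos hβ₃ hk0) hθ]
    linarith
  have hβpos : 0 < β := lt_of_lt_of_le hβ₃ hβ₃'
  haveI := isProbabilityMeasure_wilsonMeasure (d := 4) (L := L) (G := G) r.ρ r.continuous β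
  have hLnat : 0 < L := Nat.pos_of_ne_zero (NeZero.ne L)
  have hLr : (0 : ℝ) < (L : ℝ) := Nat.cast_pos.2 hLnat
  have hL4 : (0 : ℝ) < (L : ℝ) ^ 4 := by positivity
  -- Chebyshev
  have h1 := measureReal_largeField_le r (L := L) (A := A) hβpos hθ Q
  -- chessboard-to-free-energy at `lam = θ`
  have h2 := hcz L hL𝓛 β hβpos.le θ hθ le_rfl Q
  -- free-energy increment between `(1-kθ)β` and `β`
  have h3 : torusLogPartition 4 r.ρ ((1 - k * θ) * β) L - torusLogPartition 4 r.ρ β L ≤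
      (ν₀ * Real.log (1 / (1 - k * θ)) + C) * (L : ℝ) ^ 4 := by
    have hb1 : β₃ ≤ (1 - k * θ) * β := by
      have := (div_le_iff₀ h1kθ).1 hβ
      linarith
    have hb2 : (1 - k * θ) * β ≤ β := by nlinarith [mul_pos (mul_pos hk0 hθ) hβpos]
    have h := hinc L ((1 - k * θ) * β) β hb1 hb2 hL
    have hdiv : β / ((1 - k * θ) * β) = 1 / (1 - k * θ) := by
      field_simp
    rw [hdiv] at h
    linarith
  -- combine
  have hQ : (0 : ℝ) ≤ Q.card := Nat.cast_nonneg _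
  have h4 : ∫ U, ∏ p ∈ Q, Real.exp (θ * β * plaqCost r.ρ U p) ∂(wilsonMeasure (d := 4) (L := L) r.ρ β) ≤
      Real.exp (C₁ * Q.card) := by
    refine h2.trans (Real.exp_le_exp.2 ?_)
    have hexp : 0 ≤ (Q.card : ℝ) / (k * (L : ℝ) ^ 4) := by positivity
    calc (torusLogPartition 4 r.ρ ((1 - k * θ) * β) L - torusLogPartition 4 r.ρ β L) * ((Q.card : ℝ) / (k * (L : ℝ) ^ 4))
        ≤ (ν₀ * Real.log (1 / (1 - k * θ)) + C) * (L : ℝ) ^ 4 * ((Q.card : ℝ) / (k * (L : ℝ) ^ 4)) :=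
          mul_le_mul_of_nonneg_right h3 hexp
      _ = C₁ * Q.card := by rw [hC₁]; field_simp
  have hrate : -(θ * A / 2 * Q.card) + C₁ * Q.card ≤ -(θ / 4 * A * Q.card) := by
    have hA' : 4 * C₁ ≤ θ * A := by
      have := (div_le_iff₀ hθ).1 hA
      linarith
    nlinarith
  have hreal : (wilsonMeasure (d := 4) (L := L) r.ρ β).real {U | ∀ p ∈ Q, A / (2 * β) < plaqCost r.ρ U p} ≤
      Real.exp (-(θ / 4 * A * Q.card)) :=
    calc _ ≤ Real.exp (-(θ * A / 2 * Q.card)) * Real.exp (C₁ * Q.card) :=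
          h1.trans (mul_le_mul_of_nonneg_left h4 (Real.exp_pos _).le)
      _ = Real.exp (-(θ * A / 2 * Q.card) + C₁ * Q.card) := by rw [Real.exp_add]
      _ ≤ Real.exp (-(θ / 4 * A * Q.card)) := Real.exp_le_exp.2 hrate
  rw [← ENNReal.ofReal_toReal (measure_ne_top _ _)]
  exact ENNReal.ofReal_le_ofReal hreal

end Summit.QuantumFields.YangMills.Cruxes.IR.LargeFieldRarityChessboard

end
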